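import Summits.SmoothPoincare4.SmoothPoincare4.Theses.SchoenfliesSplit
import Literature.Topology.FourManifolds.MorseReebSphereProofs

/-!
# `SchsplitCerf` — negative-side support: refutation cost (crux stmt-SmoothPoincare4-8758)

Crux `SchoenfliesSplit.SchsplitCerf` (verbatim `Literature.Topology.FourManifolds.cerf_twistedSphere_four`:
every twisted 4-sphere `D⁴ ∪_φ D⁴` is diffeomorphic to `S⁴`), cdisprove seat.

* `not_smoothPoincare4_of_not_schsplitCerf`: the tree proves that every twisted sphere is
  HOMEOMORPHIC to `S⁴` (`IsTwistedSphere.nonempty_homeomorph_sphere`, Alexander trick), so the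
  summit implies the crux and a refutation of the crux is a refutation of the summit.
* `existsExoticFourSphere_of_not_schsplitCerf`: explicitly, the carrier of a non-standard twisted
  sphere is an exotic 4-sphere in the sense of `Literature.Topology.FourManifolds.ExistsExoticFourSphere`.

Consequence for the adversary: the interface `TwistedSphere 3 φ` has NO junk model (its topology is
pinned to `S⁴`); no finite / degenerate / limiting instance can kill the crux short of `¬ SPC4`.
-/

noncomputable section

-- the prescribed namespace `Summit.<P>.<Sub>.…` duplicates `SmoothPoincare4` (P = Sub)
set_option linter.dupNamespace false

open scoped Manifold ContDiff Topology

namespace Summit.SmoothPoincare4.SmoothPoincare4.Theorems.SchsplitCerf.Negative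

open Literature.Topology.FourManifolds
open Summit.SmoothPoincare4.SmoothPoincare4.Theses.SchoenfliesSplit (SchsplitCerf)

/-- **Refutation cost of the crux.** `¬ SchsplitCerf → ¬ SmoothPoincare4`: a twisted 4-sphere is a
(compact, Hausdorff, second-countable) smooth 4-manifold homeomorphic — hence homotopy equivalent —
to `S⁴`, so the summit statement applies to it verbatim. [folklore] -/
theorem not_smoothPoincare4_of_not_schsplitCerf (h : ¬ SchsplitCerf) : ¬ _root_.SmoothPoincare4 := by
  intro hs
  refine h ?_
  intro _ φ T
  obtain ⟨e⟩ := T.isTwistedSphere.nonempty_homeomorph_sphere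
  exact hs T.carrier T.chartedSpace T.isManifold e.toHomotopyEquiv

/-- **A counterexample to the crux is an exotic 4-sphere**: if some twisted 4-sphere is not
diffeomorphic to `S⁴`, its carrier witnesses `ExistsExoticFourSphere`. [folklore] -/
theorem existsExoticFourSphere_of_not_schsplitCerf (h : ¬ SchsplitCerf) :
    ExistsExoticFourSphere := by
  by_contra hex
  refine h ?_
  intro _ φ T
  obtain ⟨e⟩ := T.isTwistedSphere.nonempty_homeomorph_sphere
  by_contra hT
  exact hex ⟨T.carrier, inferInstance, T.chartedSpace, T.isManifold, e, not_nonempty_iff.mp hT⟩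

end Summit.SmoothPoincare4.SmoothPoincare4.Theorems.SchsplitCerf.Negative

end
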